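import Mathlib.RingTheory.AlgebraicIndependent.TranscendenceBasis
import Mathlib.RingTheory.Algebraic.Integral
import Mathlib.Algebra.Polynomial.Div
import Mathlib.Algebra.Order.Rearrangement
import Literature.Computability.AlgebraicComplexity.FSV18Lemma53Reduction
import Literature.Computability.AlgebraicComplexity.FSV18JacobianCriterionCharZero
import HarnessLib

/-!
# Agrawal–Saha–Saptharishi–Saxena, *Jacobian hits circuits* (STOC 2012 / SICOMP 2016), §2:
# faithful homomorphisms (Thm. 2.1 "faithful is useful"; Lemma 7.1 = Gabizon–Raz's rank
# condenser; Lemma 2.2 = the recipe quoted as FSV Lemma 52) — val-lit t18 g2, N1 support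

Source: M. Agrawal, C. Saha, R. Saptharishi, N. Saxena, *Jacobian hits circuits: hitting-sets,
lower bounds for depth-D occur-k formulas & depth-3 transcendence degree-k circuits*,
arXiv:1111.0582 (= STOC 2012; SIAM J. Comput. 45(4), 2016), §2 and Appendix §7.1 (held:
`paper:arxiv-1111.0582`, chunks p0006 (§2) and p0017 (§7.1, the proofs)). Bib key
`AgrawalEtAl2011`; the rank condenser is [GabizonRaz2008, Lemma 6.1].

Printed definitions (p0006): "A homomorphism `Φ : 𝔽[x] → 𝔽[y]` is said to be *faithful* to a
finite set of polynomials `f ⊂ 𝔽[x]` if `trdeg_𝔽 f = trdeg_𝔽 Φ(f)`." Since `trdeg Φ(f) ≤ trdeg f`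
always (a dependence pushes forward), faithfulness is rendered WITHOUT a transcendence-degree
function as: some subfamily `f_S` has `Φ(f_S)` algebraically independent and `|S|` bounds the size
of every algebraically independent subfamily of `f` (then `|S| = trdeg f = trdeg Φ(f)`).

## What is here (theorems only; no definitions, no named facts)

* `ASSS16.aeval_eq_zero_iff_of_faithful` — **Thm. 2.1 (Faithful is useful)**: for `Φ` faithful
  to `f = (f_1, …, f_m)` and any `C ∈ 𝔽[y_1, …, y_m]`, `C(f) = 0 ↔ C(Φ(f)) = 0`; proved along the
  printed proof (p0017:L6–L24: a transcendence basis `f_S` of `f` with `Φ(f_S)` a transcendence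
  basis of `Φ(f)`; `C(f) ≠ 0` is algebraic over `𝔽(f_S)`, "clearing denominators" = a relation
  with non-zero constant term `P(f_S)`; applying `Φ` would give `P(Φ(f_S)) = 0`), with Mathlib's
  algebraic-matroid API (`AlgebraicIndepOn.insert_iff`, `IsAlgebraic.adjoin_of_forall_isAlgebraic`)
  supplying "every `f_i`, hence `C(f)`, is algebraic over `𝔽[f_S]`".
* `ASSS16.det_mul_powMatrix_ne_zero`, `ASSS16.exists_det_submatrix_mul_powMatrix_ne_zero` —
  **Lemma 7.1 (the Gabizon–Raz rank condenser, [GabizonRaz2008, Lemma 6.1])** in minor form: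
  independent rows stay independent after multiplying by `(u^{(k+1)(j+1)})` over `K[u]`
  (Gaussian elimination to echelon vectors + the unique lowest power of `u` in the Leibniz
  expansion, a strict rearrangement inequality).
* `ASSS16.rank_mul_powMatrix_eq_rank` — **Lemma 7.1 as printed**:
  `rank_{𝔽(t)} (A · (t^{ij})) = rank_𝔽 A` for `A ∈ 𝔽^{r×n}` (`𝔽(t) = FractionRing 𝔽[t]`).
* `ASSS16.exists_forall_det_mul_powMatrix_ne_zero`, `ASSS16.exists_forall_vecMul_powMatrix_injOn`,
  `ASSS16.exists_forall_aeval_psi_injOn` — **Cor. 7.2**: if `|𝔽| > tnk²`, some `α ∈ 𝔽` makes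
  `Ψ_α : x_i ↦ Σ_j y_j α^{ij}` an isomorphism on each of `t` given `k`-dimensional spaces of linear
  forms (coordinate form `det(B_ℓ · (α^{ij})) ≠ 0`; injectivity on coefficient vectors; injectivity
  of the `aeval` on the linear forms). Print gives no proof; the standard one is typed (the product
  of the `t` determinants is a non-zero polynomial of degree `≤ tnk²`, Lemma 7.1, so it has a
  non-root).
* `ForbesShpilkaVolk2018_lemma52_of_fact51` — **Lemma 2.2 (the recipe `x_i ↦ Σ_j y_j t^{ij} + Ψ(x_i)`
  is faithful) ⇒ FSV Lemma 52**, PROVED modulo the Jacobian criterion (FSV Fact 51 = ASSS Fact 1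
  [BMS13]) exactly as print uses it; with val-lit t21's `ForbesShpilkaVolk2018_fact51_of_charZero`:
  `ForbesShpilkaVolk2018_lemma52_of_charZero`, `ForbesShpilkaVolk2018_lemma53_of_charZero` and the
  §6 bullet of FSV Thm. 9 over characteristic-`0` fields, `FSV2018_thm9_sparseTrdeg_charZero`, are
  unconditional theorems.

Honest framing: typed-and-proved literature in support of the FSV §6 chain (Lemma 52); `VP ≠ VNP`
is NOT proved and nothing here is progress on it.

## References
* [AgrawalEtAl2011] Agrawal–Saha–Saptharishi–Saxena, arXiv:1111.0582, §2 (Def. 4, Thm. 2.1,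
  Lemma 2.2) and §7.1 (proofs; Lemma 7.1, Cor. 7.2). locator: paper:arxiv-1111.0582
  p0006.txt:L34–L60, p0017.txt:L3–L100 (Lemma 7.1: L31–L37; Cor. 7.2: L39–L50)
* [GabizonRaz2008] A. Gabizon, R. Raz, *Deterministic extractors for affine sources over large
  fields*, Combinatorica 28 (2008), Lemma 6.1 (the rank condenser `(t^{ij})`).
* [ForbesShpilkaVolk2018] FSV, Lemma 52 (seq.) = ToC Lemma 6.3 = the recipe as quoted.
-/

noncomputable section

namespace Literature.Computability.AlgebraicComplexity

open MvPolynomial Finset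

namespace ASSS16

/-! ### Thm. 2.1 — faithful homomorphisms preserve (non-)vanishing of `C(f_1, …, f_m)` -/

section FaithfulIsUseful

variable {F : Type*} [Field F] {σ τ κ : Type*}

/-- In a faithful situation every `f_j` is algebraic over `𝔽[f_S]` (the printed "`𝕂 = 𝔽(f)`
essentially consists of elements that are polynomials in `f_{s+1}, …, f_m` with coefficients from
`𝔽(f_1, …, f_s)`"): if `f_j` were transcendental over `𝔽[f_S]`, `f_{S ∪ {j}}` would be an
algebraically independent subfamily larger than `S`.
[cite: AgrawalEtAl2011, Thm. 2.1 (proof)] locator: paper:arxiv-1111.0582 p0017.txt:L10–L13 -/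
theorem isAlgebraic_adjoin_of_maximal (f : κ → MvPolynomial σ F) (S : Finset κ)
    (hS : AlgebraicIndependent F (fun i : S => f i))
    (hmax : ∀ S' : Finset κ, AlgebraicIndependent F (fun i : S' => f i) → S'.card ≤ S.card)
    (j : κ) : IsAlgebraic (Algebra.adjoin F (Set.range fun i : S => f i)) (f j) := by
  classical
  by_cases hj : j ∈ S
  · exact isAlgebraic_algebraMap
      (⟨f j, Algebra.subset_adjoin ⟨⟨j, hj⟩, rfl⟩⟩ :
        Algebra.adjoin F (Set.range fun i : S => f i))
  · by_contra htr
    have hjS : j ∉ (S : Set κ) := fun h => hj (Finset.mem_coe.1 h)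
    have hS' : AlgebraicIndepOn F f (S : Set κ) := hS
    have hins : AlgebraicIndepOn F f (insert j (S : Set κ)) := by
      refine (AlgebraicIndepOn.insert_iff hjS).2 ⟨hS', ?_⟩
      rw [Set.image_eq_range]
      exact htr
    rw [← Finset.coe_insert] at hins
    have hcard := hmax (insert j S) hins
    rw [Finset.card_insert_of_notMem hj] at hcard
    omega

/-- **ASSS Thm. 2.1 (Faithful is useful).** Printed: "Let `f = {f_1, ⋯, f_m} ⊂ 𝔽[x]` and `Φ` be
a homomorphism faithful to `f`. For any polynomial `C ∈ 𝔽[y_1, ⋯, y_m]`,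
`C(f) = 0 ⇔ C(Φ(f)) = 0`." Faithfulness (`trdeg f = trdeg Φ(f)`, Def. 4) is taken in the
witnessed form: a subfamily `S` with `Φ(f_S)` algebraically independent whose size bounds every
algebraically independent subfamily of `f` (equivalent, since `trdeg Φ(f) ≤ trdeg f` always).
Proof as printed (§7.1): `f_S` is then a transcendence basis of `f` (`isAlgebraic_adjoin_of_maximal`),
so `C(f) ≠ 0` is algebraic over `𝔽[f_S]`; a relation of least degree has a non-zero constant term
`P(f_S)` ("clearing off the denominators … `Q̃·C = P(f_1, …, f_s)`"), and applying `Φ` to it with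
`Φ(C(f)) = 0` gives `P(Φ(f_S)) = 0`, "which is not possible as `Φ(f_1), …, Φ(f_s)` are
algebraically independent and `P` is a nontrivial polynomial".
[cite: AgrawalEtAl2011, Thm. 2.1] locator: paper:arxiv-1111.0582 p0006.txt:L40–L44 (statement),
p0017.txt:L3–L24 (proof) -/
theorem aeval_eq_zero_iff_of_faithful (f : κ → MvPolynomial σ F)
    (Φ : MvPolynomial σ F →ₐ[F] MvPolynomial τ F) (S : Finset κ)
    (hS : AlgebraicIndependent F (fun i : S => Φ (f i)))
    (hmax : ∀ S' : Finset κ, AlgebraicIndependent F (fun i : S' => f i) → S'.card ≤ S.card)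
    (C : MvPolynomial κ F) : aeval f C = 0 ↔ aeval (fun i => Φ (f i)) C = 0 := by
  classical
  constructor
  · intro h
    rw [← comp_aeval_apply, h, map_zero]
  intro hΦ
  by_contra hne
  -- abbreviations
  set g : MvPolynomial σ F := aeval f C with hg
  have hΦg : Φ g = 0 := by rw [hg, comp_aeval_apply]; exact hΦ
  -- `f_S` is algebraically independent (its image under `Φ` is)
  have hfS : AlgebraicIndependent F (fun i : S => f i) := AlgebraicIndependent.of_comp Φ hS
  -- `g = C(f)` is algebraic over `𝔽[f_S]`
  have hgalg : IsAlgebraic (Algebra.adjoin F (Set.range fun i : S => f i)) g := by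
    have hgmem : g ∈ Algebra.adjoin F (Set.range f) := by
      rw [Algebra.adjoin_range_eq_range_aeval]
      exact ⟨C, rfl⟩
    have h1 : IsAlgebraic (Algebra.adjoin F (Set.range f)) g :=
      isAlgebraic_algebraMap (⟨g, hgmem⟩ : Algebra.adjoin F (Set.range f))
    refine h1.adjoin_of_forall_isAlgebraic fun x hx => ?_
    obtain ⟨j, rfl⟩ := hx.1
    exact isAlgebraic_adjoin_of_maximal f S hfS hmax j
  -- a relation of least degree; its constant term is non-zero since `g ≠ 0` in a domain
  have hex : ∃ n, ∃ p : Polynomial (Algebra.adjoin F (Set.range fun i : S => f i)),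
      p ≠ 0 ∧ Polynomial.aeval g p = 0 ∧ p.natDegree = n := by
    obtain ⟨p, hp0, hpg⟩ := hgalg
    exact ⟨_, p, hp0, hpg, rfl⟩
  obtain ⟨p, hp0, hpg, hdeg⟩ := Nat.find_spec hex
  have hc0 : p.coeff 0 ≠ 0 := by
    intro h0
    obtain ⟨q, rfl⟩ := Polynomial.X_dvd_iff.2 h0
    have hq0 : q ≠ 0 := by
      rintro rfl
      exact hp0 (mul_zero _)
    have hqg : Polynomial.aeval g q = 0 := by
      have h1 : g * Polynomial.aeval g q = 0 := by
        simpa only [map_mul, Polynomial.aeval_X] using hpg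
      exact (mul_eq_zero.1 h1).resolve_left hne
    have hlt : q.natDegree < Nat.find hex := by
      rw [← hdeg, Polynomial.natDegree_X_mul hq0]
      exact Nat.lt_succ_self _
    exact Nat.find_min hex hlt ⟨q, hq0, hqg, rfl⟩
  -- the constant term is `P₀(f_S)` for a non-zero `P₀`
  obtain ⟨P₀, hP₀⟩ : ∃ P₀ : MvPolynomial S F,
      aeval (fun i : S => f i) P₀ = ((p.coeff 0 : Algebra.adjoin F (Set.range fun i : S => f i)) :
        MvPolynomial σ F) := by
    have hmem : ((p.coeff 0 : Algebra.adjoin F (Set.range fun i : S => f i)) :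
        MvPolynomial σ F) ∈
          (aeval (R := F) (S₁ := MvPolynomial σ F) (fun i : S => f i)).range := by
      rw [← Algebra.adjoin_range_eq_range_aeval]
      exact (p.coeff 0).2
    exact (AlgHom.mem_range _).1 hmem
  have hP₀ne : P₀ ≠ 0 := by
    rintro rfl
    apply hc0
    exact Subtype.ext (by rw [← hP₀, map_zero]; rfl)
  -- apply `Φ` to the relation: all terms but the constant one contain `Φ(g) = 0`
  have hsum : ∑ i ∈ Finset.range (p.natDegree + 1),
      ((p.coeff i : Algebra.adjoin F (Set.range fun i : S => f i)) : MvPolynomial σ F) * g ^ i =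
        0 := by
    have h1 := hpg
    rw [Polynomial.aeval_eq_sum_range] at h1
    simpa only [Subalgebra.smul_def, smul_eq_mul] using h1
  apply_fun Φ at hsum
  rw [map_sum, map_zero, Finset.sum_eq_single 0] at hsum
  · rw [pow_zero, mul_one, ← hP₀, comp_aeval_apply] at hsum
    exact hP₀ne (hS (show aeval _ P₀ = aeval _ 0 by rw [map_zero]; exact hsum))
  · intro i _ hi0
    rw [map_mul, map_pow, hΦg, zero_pow hi0, mul_zero]
  · intro h
    exact absurd (Finset.mem_range.2 (Nat.succ_pos _)) h

end FaithfulIsUseful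

/-! ### Lemma 7.1 — the Gabizon–Raz rank condenser `(t^{ij})` (lowest-term argument) -/

section RankCondenser

open Polynomial

variable {K : Type*} [Field K]

/-- Gaussian elimination: a subspace of `K^N` of dimension `≥ ρ` contains `ρ` vectors in echelon
form (strictly increasing pivot columns `c_a`, zero before the pivot, non-zero at it).
[folklore] -/
private theorem exists_echelon {N : ℕ} :
    ∀ (ρ : ℕ) (W : Submodule K (Fin N → K)), ρ ≤ Module.finrank K W →
      ∃ (E : Fin ρ → (Fin N → K)) (c : Fin ρ → Fin N), StrictMono c ∧ (∀ a, E a ∈ W) ∧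
        (∀ a, E a (c a) ≠ 0) ∧ ∀ a k, k < c a → E a k = 0 := by
  intro ρ
  induction ρ with
  | zero =>
    intro W _
    exact ⟨fun a => Fin.elim0 a, fun a => Fin.elim0 a, fun a => Fin.elim0 a, fun a => Fin.elim0 a,
      fun a => Fin.elim0 a, fun a => Fin.elim0 a⟩
  | succ ρ ih =>
    intro W hW
    classical
    have hpos : 0 < Module.finrank K W := by omega
    obtain ⟨⟨w, hwW⟩, hw0⟩ := Module.finrank_pos_iff_exists_ne_zero.1 hpos
    have hw0' : w ≠ 0 := fun h => hw0 (Subtype.ext h)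
    have hne : (Finset.univ.filter fun k : Fin N => ∃ v ∈ W, v k ≠ 0).Nonempty := by
      obtain ⟨k, hk⟩ : ∃ k, w k ≠ 0 := by
        by_contra h
        push Not at h
        exact hw0' (funext h)
      exact ⟨k, Finset.mem_filter.2 ⟨Finset.mem_univ _, w, hwW, hk⟩⟩
    set c₀ := (Finset.univ.filter fun k : Fin N => ∃ v ∈ W, v k ≠ 0).min' hne with hc₀
    obtain ⟨w₀, hw₀W, hw₀c⟩ : ∃ v ∈ W, v c₀ ≠ 0 :=
      (Finset.mem_filter.1 (Finset.min'_mem _ hne)).2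
    have hzero : ∀ v ∈ W, ∀ k, k < c₀ → v k = 0 := by
      intro v hv k hk
      by_contra hvk
      have : c₀ ≤ k :=
        Finset.min'_le _ _ (Finset.mem_filter.2 ⟨Finset.mem_univ _, v, hv, hvk⟩)
      exact absurd hk (not_lt.2 this)
    -- the part of `W` vanishing at `c₀` has dimension `≥ ρ`
    set L : Submodule K (Fin N → K) :=
      LinearMap.ker (LinearMap.proj (R := K) (φ := fun _ : Fin N => K) c₀) with hL
    have hW' : ρ ≤ Module.finrank K ↥(W ⊓ L) := by
      have h1 := Submodule.finrank_sup_add_finrank_inf_eq W L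
      have h2 : Module.finrank K L + 1 = N := by
        have h3 := LinearMap.finrank_range_add_finrank_ker
          (LinearMap.proj (R := K) (φ := fun _ : Fin N => K) c₀)
        rw [LinearMap.range_eq_top.2 (fun x => ⟨Pi.single c₀ x, by simp⟩), finrank_top,
          Module.finrank_self, Module.finrank_fin_fun] at h3
        rw [hL]
        omega
      have h4 : Module.finrank K ↥(W ⊔ L) ≤ N :=
        (Submodule.finrank_le _).trans (Module.finrank_fin_fun K).le
      omega
    obtain ⟨E', c', hc'mono, hE'W, hE'piv, hE'zero⟩ := ih (W ⊓ L) hW'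
    have hc'gt : ∀ a, c₀ < c' a := by
      intro a
      by_contra hle
      rcases (not_lt.1 hle).lt_or_eq with hlt | heq
      · exact hE'piv a (hzero _ (Submodule.mem_inf.1 (hE'W a)).1 _ hlt)
      · have hker := (Submodule.mem_inf.1 (hE'W a)).2
        rw [hL, LinearMap.mem_ker, LinearMap.proj_apply] at hker
        exact hE'piv a (by rw [heq]; exact hker)
    refine ⟨Fin.cons w₀ E', Fin.cons c₀ c', ?_, ?_, ?_, ?_⟩
    · intro i j hij
      revert hij
      refine Fin.cases (fun h => ?_) (fun j' h => ?_) j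
      · exact absurd h (by simp)
      · revert h
        refine Fin.cases (fun _ => ?_) (fun i' h => ?_) i
        · simp only [Fin.cons_zero, Fin.cons_succ]
          exact hc'gt j'
        · simp only [Fin.cons_succ]
          exact hc'mono (Fin.succ_lt_succ_iff.1 h)
    · intro a
      refine Fin.cases ?_ (fun a => ?_) a
      · simpa using hw₀W
      · simpa using (Submodule.mem_inf.1 (hE'W a)).1
    · intro a
      refine Fin.cases ?_ (fun a => ?_) a
      · simpa using hw₀c
      · simpa using hE'piv a
    · intro a
      refine Fin.cases ?_ (fun a => ?_) a
      · intro k hk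
        simp only [Fin.cons_zero] at hk ⊢
        exact hzero _ hw₀W _ hk
      · intro k hk
        simp only [Fin.cons_succ] at hk ⊢
        exact hE'zero a k hk

/-- Strict rearrangement: with strictly increasing pivots `c`, the exponent
`Σ_a (c_{σ(a)} + 1)(a + 1)` is uniquely minimised by the order-reversing permutation. [folklore] -/
private theorem sum_rev_lt_sum_perm {N ρ : ℕ} {c : Fin ρ → Fin N} (hc : StrictMono c)
    {σ : Equiv.Perm (Fin ρ)} (hσ : σ ≠ Fin.revPerm) :
    ∑ a : Fin ρ, ((c (Fin.revPerm a) : ℕ) + 1) * ((a : ℕ) + 1) <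
      ∑ a : Fin ρ, ((c (σ a) : ℕ) + 1) * ((a : ℕ) + 1) := by
  set f : Fin ρ → ℕ := fun a => (a : ℕ) + 1 with hf
  set g : Fin ρ → ℕ := fun a => (c (Fin.rev a) : ℕ) + 1 with hg
  set τ : Equiv.Perm (Fin ρ) := σ.trans Fin.revPerm with hτ
  have hfg : Antivary f g := by
    intro i j hij
    have h1 : c (Fin.rev i) < c (Fin.rev j) := by
      simp only [hg] at hij
      exact_mod_cast Nat.lt_of_succ_lt_succ hij
    have hji : j < i := Fin.rev_lt_rev.1 (hc.lt_iff_lt.1 h1)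
    simp only [hf]
    exact Nat.succ_le_succ hji.le
  have hgτ : ∀ a, g (τ a) = (c (σ a) : ℕ) + 1 := fun a => by
    simp [hg, hτ, Fin.rev_rev]
  have hsum1 : ∑ a, f a * g a = ∑ a : Fin ρ, ((c (Fin.revPerm a) : ℕ) + 1) * ((a : ℕ) + 1) :=
    Finset.sum_congr rfl fun a _ => by simp [hf, hg, mul_comm]
  have hsum2 : ∑ a, f a * g (τ a) = ∑ a : Fin ρ, ((c (σ a) : ℕ) + 1) * ((a : ℕ) + 1) :=
    Finset.sum_congr rfl fun a _ => by rw [hgτ, mul_comm]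
  have hle := hfg.sum_mul_le_sum_mul_comp_perm (σ := τ)
  rw [hsum1, hsum2] at hle
  refine lt_of_le_of_ne hle fun heq => hσ ?_
  have hanti : Antivary f (g ∘ τ) :=
    hfg.sum_mul_eq_sum_mul_comp_perm_iff.1 (by rw [hsum1, hsum2]; exact heq.symm)
  have hτmono : StrictMono τ := by
    intro i j hij
    rcases lt_trichotomy (τ i) (τ j) with h | h | h
    · exact h
    · exact absurd (τ.injective h) hij.ne
    · exfalso
      have h1 : (g ∘ τ) i < (g ∘ τ) j := by
        simp only [Function.comp_apply, hg]
        exact Nat.succ_lt_succ (hc (Fin.rev_lt_rev.2 h))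
      have h2 := hanti h1
      simp only [hf] at h2
      exact absurd (Fin.lt_def.1 hij) (not_lt.2 (Nat.le_of_succ_le_succ h2))
  have hτid : (τ : Fin ρ → Fin ρ) = id :=
    (hτmono.range_inj strictMono_id).1 (by rw [Set.range_id]; exact τ.surjective.range_eq)
  ext a
  have h1 : Fin.rev (σ a) = a := by
    have := congrFun hτid a
    simpa [hτ] using this
  have h2 := congrArg Fin.rev h1
  rw [Fin.rev_rev] at h2
  simp [h2]

/-- **Core of Lemma 7.1 (Gabizon–Raz [GabizonRaz2008, Lemma 6.1]):** if the rows of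
`Q ∈ K^{ρ×N}` are linearly independent, then `det (Q · (u^{(k+1)(a+1)})_{k<N, a<ρ}) ≠ 0` in
`K[u]` — after Gaussian elimination of the row space (`E = G·Q` in echelon form with pivots
`c_1 < ⋯ < c_ρ`), the Leibniz term of the order-reversing permutation contributes the unique
lowest power `u^{Σ_a (c_{ρ-a}+1)(a+1)}`, with coefficient `± ∏ E_{a,c_a} ≠ 0`.
[cite: AgrawalEtAl2011, Lemma 7.1 (proof: "Follows from Lemma 6.1 of [GR05]")]
locator: paper:arxiv-1111.0582 p0017.txt:L31–L37 -/
theorem det_mul_powMatrix_ne_zero {N ρ : ℕ} (Q : Matrix (Fin ρ) (Fin N) K)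
    (hQ : LinearIndependent K (fun a : Fin ρ => Q a)) :
    (Q.map (Polynomial.C : K →+* K[X]) *
      Matrix.of (fun (k : Fin N) (a : Fin ρ) =>
        (Polynomial.X : K[X]) ^ (((k : ℕ) + 1) * ((a : ℕ) + 1)))).det ≠ 0 := by
  classical
  set V : Matrix (Fin N) (Fin ρ) K[X] :=
    Matrix.of (fun (k : Fin N) (a : Fin ρ) => (Polynomial.X : K[X]) ^ (((k : ℕ) + 1) * ((a : ℕ) + 1)))
    with hV
  -- echelon vectors `E = G · Q` in the row space
  set W := Submodule.span K (Set.range fun a : Fin ρ => Q a) with hW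
  have hfin : ρ ≤ Module.finrank K W := by
    rw [hW, finrank_span_eq_card hQ, Fintype.card_fin]
  obtain ⟨E, c, hc, hEW, hEpiv, hEzero⟩ := exists_echelon ρ W hfin
  have hG : ∀ a, ∃ G : Fin ρ → K, ∑ b, G b • Q b = E a := fun a =>
    (Submodule.mem_span_range_iff_exists_fun K).1 (hEW a)
  choose G hG using hG
  have hEGQ : (Matrix.of E).map (Polynomial.C : K →+* K[X]) * V =
      (Matrix.of G).map (Polynomial.C : K →+* K[X]) * (Q.map (Polynomial.C : K →+* K[X]) * V) := by
    rw [← Matrix.mul_assoc, ← Matrix.map_mul]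
    congr 2
    ext a k
    rw [Matrix.mul_apply, Matrix.of_apply, ← hG a]
    simp [Finset.sum_apply, Matrix.of_apply]
  suffices h : ((Matrix.of E).map (Polynomial.C : K →+* K[X]) * V).det ≠ 0 by
    intro h0
    apply h
    rw [hEGQ, Matrix.det_mul, h0, mul_zero]
  -- the Leibniz expansion of `det (E · V)`
  set M := (Matrix.of E).map (Polynomial.C : K →+* K[X]) * V with hM
  have hentry : ∀ b a, M b a = Polynomial.X ^ (((c b : ℕ) + 1) * ((a : ℕ) + 1)) *
      ∑ k : Fin N, Polynomial.C (E b k) * Polynomial.X ^ (((k : ℕ) - (c b : ℕ)) * ((a : ℕ) + 1)) := by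
    intro b a
    rw [hM, Matrix.mul_apply, Finset.mul_sum]
    refine Finset.sum_congr rfl fun k _ => ?_
    simp only [Matrix.map_apply, Matrix.of_apply, hV]
    by_cases hk : c b ≤ k
    · have hk' : (c b : ℕ) ≤ k := hk
      rw [mul_left_comm, ← pow_add]
      congr 2
      have h1 : (k : ℕ) + 1 = ((c b : ℕ) + 1) + ((k : ℕ) - (c b : ℕ)) := by omega
      rw [h1, add_mul]
    · rw [hEzero b k (not_le.1 hk), map_zero, zero_mul, zero_mul, mul_zero]
  have hinner : ∀ b a, (∑ k : Fin N, Polynomial.C (E b k) *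
      Polynomial.X ^ (((k : ℕ) - (c b : ℕ)) * ((a : ℕ) + 1))).coeff 0 = E b (c b) := by
    intro b a
    rw [Polynomial.finsetSum_coeff, Finset.sum_eq_single (c b)]
    · simp
    · intro k _ hk
      rw [Polynomial.coeff_C_mul, Polynomial.coeff_X_pow]
      by_cases hlt : k < c b
      · rw [hEzero b k hlt, zero_mul]
      · have hgt : (c b : ℕ) < k := lt_of_le_of_ne (not_lt.1 hlt) (fun h => hk (Fin.ext h).symm)
        have hne : ((k : ℕ) - (c b : ℕ)) * ((a : ℕ) + 1) ≠ 0 := Nat.mul_ne_zero (by omega) (by omega)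
        rw [if_neg (fun h => hne h.symm), mul_zero]
    · intro h
      exact absurd (Finset.mem_univ _) h
  have hprod : ∀ σ : Equiv.Perm (Fin ρ), ∏ a, M (σ a) a =
      Polynomial.X ^ (∑ a : Fin ρ, ((c (σ a) : ℕ) + 1) * ((a : ℕ) + 1)) *
        ∏ a, ∑ k : Fin N, Polynomial.C (E (σ a) k) *
          Polynomial.X ^ (((k : ℕ) - (c (σ a) : ℕ)) * ((a : ℕ) + 1)) := by
    intro σ
    simp_rw [hentry]
    rw [Finset.prod_mul_distrib, Finset.prod_pow_eq_pow_sum]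
  -- the coefficient of the lowest power `u^{e₀}`, `e₀ = Σ_a (c_{rev a}+1)(a+1)`
  have hcoeff : M.det.coeff (∑ a : Fin ρ, ((c (Fin.revPerm a) : ℕ) + 1) * ((a : ℕ) + 1)) =
      ((Equiv.Perm.sign (Fin.revPerm : Equiv.Perm (Fin ρ)) : ℤ) : K) *
        ∏ a : Fin ρ, E (Fin.revPerm a) (c (Fin.revPerm a)) := by
    rw [Matrix.det_apply', Polynomial.finsetSum_coeff, Finset.sum_eq_single Fin.revPerm]
    · rw [hprod, ← map_intCast (Polynomial.C : K →+* K[X]), Polynomial.coeff_C_mul,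
        Polynomial.coeff_X_pow_mul', if_pos le_rfl, Nat.sub_self, Polynomial.coeff_zero_prod]
      congr 1
      exact Finset.prod_congr rfl fun a _ => hinner _ _
    · intro σ _ hσ
      rw [hprod, ← map_intCast (Polynomial.C : K →+* K[X]), Polynomial.coeff_C_mul,
        Polynomial.coeff_X_pow_mul', if_neg (not_le.2 (sum_rev_lt_sum_perm hc hσ)), mul_zero]
    · intro h
      exact absurd (Finset.mem_univ _) h
  intro hdet
  rw [hdet, Polynomial.coeff_zero] at hcoeff
  have hsign : ((Equiv.Perm.sign (Fin.revPerm : Equiv.Perm (Fin ρ)) : ℤ) : K) ≠ 0 := by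
    rcases Int.units_eq_one_or (Equiv.Perm.sign (Fin.revPerm : Equiv.Perm (Fin ρ))) with h | h <;>
      simp [h]
  have hprodne : ∏ a : Fin ρ, E (Fin.revPerm a) (c (Fin.revPerm a)) ≠ 0 :=
    Finset.prod_ne_zero_iff.2 fun a _ => hEpiv _
  exact mul_ne_zero hsign hprodne hcoeff.symm

/-- **ASSS Lemma 7.1 (Vandermonde map; Gabizon–Raz [GabizonRaz2008, Lemma 6.1]) in minor form
over a domain.** Printed: "Let `A` be a `r × n` matrix with entries in a field `𝔽`, and let `t` be
an indeterminate. Then `rank_{𝔽(t)} (A · (t^{ij})_{i∈[n], j∈[r]}) = rank_𝔽 A`." Typed consequence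
used by Lemma 2.2: for `P ∈ R^{m×N}` (`R` a domain) of rank `≥ ρ` over `Frac R` and `ρ ≤ r`,
some `ρ × ρ` minor of `P · (u^{(k+1)(j+1)})_{k<N, j<r}` is a non-zero polynomial in `R[u]`
(rows: `ρ` independent rows of `P`; columns: the first `ρ`; `det_mul_powMatrix_ne_zero`).
[cite: AgrawalEtAl2011, Lemma 7.1] locator: paper:arxiv-1111.0582 p0017.txt:L31–L37 -/
theorem exists_det_submatrix_mul_powMatrix_ne_zero {R : Type*} [CommRing R] [IsDomain R]
    {m N r ρ : ℕ} (P : Matrix (Fin m) (Fin N) R)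
    (hρ : ρ ≤ (P.map (algebraMap R (FractionRing R))).rank) (hρr : ρ ≤ r) :
    ∃ (rI : Fin ρ → Fin m) (cI : Fin ρ → Fin r),
      (((P.map (Polynomial.C : R →+* R[X])) *
        Matrix.of (fun (k : Fin N) (j : Fin r) =>
          (Polynomial.X : R[X]) ^ (((k : ℕ) + 1) * ((j : ℕ) + 1)))).submatrix rI cI).det ≠ 0 := by
  classical
  set K := FractionRing R
  set PK := P.map (algebraMap R K) with hPK
  -- `ρ` linearly independent rows
  have hrk : ρ ≤ (PK.transpose).rank := by
    rw [Matrix.rank_transpose]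
    exact hρ
  obtain ⟨rI, -, hli⟩ :=
    Literature.LinearAlgebra.Matrix.exists_linearIndependent_cols_of_le_rank PK.transpose hrk
  have hli' : LinearIndependent K (fun a : Fin ρ => (PK.submatrix rI id) a) := by
    have e : (fun a : Fin ρ => (PK.submatrix rI id) a) = fun a => PK.transpose.col (rI a) := by
      funext a k
      rfl
    rw [e]
    exact hli
  refine ⟨rI, Fin.castLE hρr, ?_⟩
  have hcore := det_mul_powMatrix_ne_zero (PK.submatrix rI id) hli'
  -- map the `R[u]`-minor to `K[u]`
  intro h0
  apply hcore
  have hmap := congrArg (Polynomial.mapRingHom (algebraMap R K)) h0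
  rw [map_zero, RingHom.map_det, RingHom.mapMatrix_apply] at hmap
  rw [← hmap]
  congr 1
  refine Matrix.ext fun a b => ?_
  simp only [Matrix.map_apply, Matrix.submatrix_apply, Matrix.mul_apply, Matrix.of_apply, hPK,
    Polynomial.coe_mapRingHom, Polynomial.map_sum, Polynomial.map_mul, Polynomial.map_pow,
    Polynomial.map_C, Polynomial.map_X, Fin.val_castLE, id]

end RankCondenser

/-! ### Lemma 2.2 — the recipe `x_i ↦ Σ_j y_j t^{ij} + Ψ(x_i)` is faithful (ASSS §7.1) -/

section Recipe

open Literature.Algebra.Polynomial.JacobianCriterion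

variable {F : Type*} [Field F]

/-- The partial derivative of the recipe's `k`-th coordinate `Σ_j s_j t^{(k+1)(j+1)} + Φ(X_k)`
(`Φ(X_k)` in the `z`-variables `Sum.inl`) with respect to the seed `s_j` is `t^{(k+1)(j+1)}`: "the
matrix `J_y(Φ(x))` is exactly the Vandermonde matrix". [cite: AgrawalEtAl2011, Lemma 2.2 (proof, §7.1)]
locator: paper:arxiv-1111.0582 p0017.txt:L86–L87 -/
theorem pderiv_recipe {N M r : ℕ} (q : MvPolynomial (Fin M) F) (k : Fin N) (j : Fin r) :
    pderiv (Sum.inr (Sum.inl j))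
      ((∑ j' : Fin r, (X (Sum.inr (Sum.inl j')) : MvPolynomial (Fin M ⊕ (Fin r ⊕ Unit)) F) *
          X (Sum.inr (Sum.inr ())) ^ (((k : ℕ) + 1) * ((j' : ℕ) + 1))) +
        rename Sum.inl q) =
      X (Sum.inr (Sum.inr ())) ^ (((k : ℕ) + 1) * ((j : ℕ) + 1)) := by
  classical
  have hq : pderiv (Sum.inr (Sum.inl j) : Fin M ⊕ (Fin r ⊕ Unit)) (rename Sum.inl q) = 0 := by
    refine pderiv_eq_zero_of_notMem_vars fun h => ?_
    obtain ⟨x, -, hx⟩ := Finset.mem_image.1 (vars_rename _ _ h)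
    exact Sum.inl_ne_inr hx
  rw [map_add, hq, add_zero, map_sum]
  rw [Finset.sum_eq_single j]
  · rw [pderiv_mul, pderiv_X_self, one_mul, pderiv_pow, pderiv_X_of_ne (by simp)]
    simp
  · intro j' _ hj'
    rw [pderiv_mul, pderiv_X_of_ne (by simpa using hj'), zero_mul, pderiv_pow,
      pderiv_X_of_ne (by simp)]
    simp
  · intro h
    exact absurd (Finset.mem_univ _) h

end Recipe

/-! ### Lemma 7.1 as printed (rank over `𝔽(t)`) and Corollary 7.2 (a good `α ∈ 𝔽`) -/

section RankCondenserPrinted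

open Polynomial

variable {K : Type*} [Field K]

/-- The rank of a matrix over a field is unchanged by an embedding into a larger field (rank =
largest size of a non-vanishing minor, `Literature.LinearAlgebra.Matrix.RankMinors`, and minors
commute with ring maps). [folklore] -/
private theorem rank_map_eq_of_injective {L : Type*} [Field L] {m n : Type*} [Fintype m]
    [Fintype n] (f : K →+* L) (A : Matrix m n K) : (A.map f).rank = A.rank := by
  classical
  apply le_antisymm
  · refine Literature.LinearAlgebra.Matrix.rank_le_of_det_submatrix_eq_zero _ fun r c => ?_
    rw [Matrix.submatrix_map, ← RingHom.mapMatrix_apply, ← RingHom.map_det,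
      Literature.LinearAlgebra.Matrix.det_submatrix_eq_zero_of_rank_lt_card A r c (by simp),
      map_zero]
  · obtain ⟨r, c, hne⟩ :=
      (Literature.LinearAlgebra.Matrix.le_rank_iff_exists_det_submatrix_ne_zero A).1 le_rfl
    refine (Literature.LinearAlgebra.Matrix.le_rank_iff_exists_det_submatrix_ne_zero _).2
      ⟨r, c, ?_⟩
    rw [Matrix.submatrix_map, ← RingHom.mapMatrix_apply, ← RingHom.map_det]
    exact (map_ne_zero_iff f f.injective).2 hne

/-- **ASSS Lemma 7.1 as printed (Vandermonde map; Gabizon–Raz [GabizonRaz2008, Lemma 6.1]).**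
"Let `A` be a `r × n` matrix with entries in a field `𝔽`, and let `t` be an indeterminate. Then
`rank_{𝔽(t)} (A · (t^{ij})_{i∈[n], j∈[r]}) = rank_𝔽 A`." Here `𝔽(t)` is `FractionRing 𝔽[t]`,
the exponent `ij` is `(i+1)(j+1)` on `0`-based indices, and `rank` is `Matrix.rank` (column rank =
row rank over a field). Proof: `≤` from `rank (A·V) ≤ rank A` and invariance of rank under the
field extension `𝔽 ⊆ 𝔽(t)`; `≥` from the non-vanishing `rank A × rank A` minor of
`exists_det_submatrix_mul_powMatrix_ne_zero` (the lowest-term argument of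
`det_mul_powMatrix_ne_zero`). [cite: AgrawalEtAl2011, Lemma 7.1]
locator: paper:arxiv-1111.0582 p0017.txt:L31–L37 -/
theorem rank_mul_powMatrix_eq_rank {n r : ℕ} (A : Matrix (Fin r) (Fin n) K) :
    (((A.map (Polynomial.C : K →+* K[X])) *
        Matrix.of (fun (i : Fin n) (j : Fin r) =>
          (Polynomial.X : K[X]) ^ (((i : ℕ) + 1) * ((j : ℕ) + 1)))).map
      (algebraMap K[X] (FractionRing K[X]))).rank = A.rank := by
  classical
  set L := FractionRing K[X]
  set φ : K[X] →+* L := algebraMap K[X] L with hφ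
  set V : Matrix (Fin n) (Fin r) K[X] :=
    Matrix.of (fun (i : Fin n) (j : Fin r) =>
      (Polynomial.X : K[X]) ^ (((i : ℕ) + 1) * ((j : ℕ) + 1))) with hV
  have hφinj : Function.Injective φ := IsFractionRing.injective K[X] L
  apply le_antisymm
  · have e : ((A.map (Polynomial.C : K →+* K[X])) * V).map φ =
        A.map (φ.comp Polynomial.C) * V.map φ := by
      rw [Matrix.map_mul, Matrix.map_map]
      rfl
    rw [e]
    exact (Matrix.rank_mul_le_left _ _).trans (rank_map_eq_of_injective _ A).le
  · have hr : A.rank ≤ r := by simpa using Matrix.rank_le_height A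
    have hrk : A.rank ≤ (A.map (algebraMap K (FractionRing K))).rank :=
      (rank_map_eq_of_injective _ A).ge
    obtain ⟨rI, cI, hne⟩ := exists_det_submatrix_mul_powMatrix_ne_zero A hrk hr
    have h := Literature.LinearAlgebra.Matrix.card_le_rank_of_det_submatrix_ne_zero
      ((((A.map (Polynomial.C : K →+* K[X])) * V).map φ)) rI cI (by
        rw [Matrix.submatrix_map, ← RingHom.mapMatrix_apply, ← RingHom.map_det]
        exact (map_ne_zero_iff φ hφinj).2 hne)
    simpa using h

/-- Degree count for Cor. 7.2: every entry of `B · (u^{(x+1)(j+1)})` has degree `≤ n·k`, so the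
`k × k` determinant has degree `≤ k · (n·k) = n·k²`. [folklore] -/
private theorem natDegree_det_mul_powMatrix_le {n k : ℕ} (B : Matrix (Fin k) (Fin n) K) :
    ((B.map (Polynomial.C : K →+* K[X])) *
        Matrix.of (fun (x : Fin n) (j : Fin k) =>
          (Polynomial.X : K[X]) ^ (((x : ℕ) + 1) * ((j : ℕ) + 1)))).det.natDegree ≤ n * k ^ 2 := by
  classical
  set M := (B.map (Polynomial.C : K →+* K[X])) *
        Matrix.of (fun (x : Fin n) (j : Fin k) =>
          (Polynomial.X : K[X]) ^ (((x : ℕ) + 1) * ((j : ℕ) + 1))) with hM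
  have hentry : ∀ a j, (M a j).natDegree ≤ n * k := by
    intro a j
    rw [hM, Matrix.mul_apply]
    refine natDegree_sum_le_of_forall_le _ _ fun x _ => ?_
    rw [Matrix.map_apply, Matrix.of_apply]
    refine (natDegree_C_mul_X_pow_le _ _).trans ?_
    exact Nat.mul_le_mul (Nat.succ_le_of_lt x.isLt) (Nat.succ_le_of_lt j.isLt)
  rw [Matrix.det_apply']
  refine natDegree_sum_le_of_forall_le _ _ fun σ _ => ?_
  refine natDegree_mul_le.trans ?_
  rw [natDegree_intCast, zero_add]
  refine (natDegree_prod_le _ _).trans ?_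
  calc ∑ i, (M (σ i) i).natDegree ≤ ∑ _i : Fin k, n * k :=
        Finset.sum_le_sum fun i _ => hentry _ _
    _ = n * k ^ 2 := by simp; ring

/-- **ASSS Corollary 7.2 (a good field element for the Vandermonde map), coordinate form.**
Printed: "Let `V_1, ⋯, V_t` be `k`-dimensional subspaces of linear polynomials in
`𝔽[x_1, ⋯, x_n]`. For a constant `α ∈ 𝔽`, define the linear homomorphism
`Ψ_α : x_i ↦ ∑_{j=1}^k y_j α^{ij}`. If `|𝔽| > tnk²`, then there exists an `α` such that `Ψ_α` is
an isomorphism on each of `V_1, ⋯, V_t`." Dictionary: a linear form `∑_i v_i x_i` is its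
coefficient vector `v ∈ 𝔽^n`, on which `Ψ_α` acts as `v ↦ v · W_α`, `W_α = (α^{ij})_{i∈[n], j∈[k]}`;
`V_ℓ` = the row space of a `B_ℓ ∈ 𝔽^{k×n}` with linearly independent rows (a basis of `V_ℓ`);
"`Ψ_α` is an isomorphism on `V_ℓ`" ⟺ `B_ℓ · W_α ∈ 𝔽^{k×k}` is non-singular (typed conclusion;
the injectivity reading is `exists_forall_vecMul_powMatrix_injOn`). Exponent `ij` = `(i+1)(j+1)`
on `0`-based indices. Proof (not printed; the standard one): `∏_ℓ det(B_ℓ · (u^{ij}))` is a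
non-zero polynomial (Lemma 7.1, `det_mul_powMatrix_ne_zero`) of degree `≤ t·n·k²`, so it has a
non-root when `|𝔽| > tnk²`. [cite: AgrawalEtAl2011, Cor. 7.2]
locator: paper:arxiv-1111.0582 p0017.txt:L39–L50 -/
theorem exists_forall_det_mul_powMatrix_ne_zero {t k n : ℕ} (B : Fin t → Matrix (Fin k) (Fin n) K)
    (hB : ∀ ℓ, LinearIndependent K (fun a : Fin k => B ℓ a))
    (hK : ((t * n * k ^ 2 : ℕ) : Cardinal) < Cardinal.mk K) :
    ∃ α : K, ∀ ℓ, (B ℓ * Matrix.of (fun (x : Fin n) (j : Fin k) =>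
      α ^ (((x : ℕ) + 1) * ((j : ℕ) + 1)))).det ≠ 0 := by
  classical
  set V : Matrix (Fin n) (Fin k) K[X] :=
    Matrix.of (fun (x : Fin n) (j : Fin k) =>
      (Polynomial.X : K[X]) ^ (((x : ℕ) + 1) * ((j : ℕ) + 1))) with hV
  set P : K[X] := ∏ ℓ, ((B ℓ).map (Polynomial.C : K →+* K[X]) * V).det with hP
  have hP0 : P ≠ 0 :=
    Finset.prod_ne_zero_iff.2 fun ℓ _ => det_mul_powMatrix_ne_zero (B ℓ) (hB ℓ)
  have hdeg : P.natDegree ≤ t * n * k ^ 2 := by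
    refine (natDegree_prod_le _ _).trans ?_
    calc ∑ ℓ, ((B ℓ).map (Polynomial.C : K →+* K[X]) * V).det.natDegree
          ≤ ∑ _ℓ : Fin t, n * k ^ 2 :=
          Finset.sum_le_sum fun ℓ _ => natDegree_det_mul_powMatrix_le (B ℓ)
      _ = t * n * k ^ 2 := by simp; ring
  have hlt : (P.natDegree : Cardinal) < Cardinal.mk K :=
    lt_of_le_of_lt (by exact_mod_cast hdeg) hK
  obtain ⟨α, hα⟩ := P.exists_eval_ne_zero_of_natDegree_lt_card hP0 hlt
  refine ⟨α, fun ℓ => ?_⟩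
  rw [hP, Polynomial.eval_prod] at hα
  have hℓ := (Finset.prod_ne_zero_iff.1 hα) ℓ (Finset.mem_univ _)
  rw [← Polynomial.coe_evalRingHom, RingHom.map_det, RingHom.mapMatrix_apply] at hℓ
  convert hℓ using 2
  refine Matrix.ext fun a j => ?_
  simp [Matrix.mul_apply, hV, Polynomial.eval_finsetSum]

/-- **ASSS Corollary 7.2, injectivity reading** ("`Ψ_α` is an isomorphism on each of
`V_1, ⋯, V_t`"): with `α` as in `exists_forall_det_mul_powMatrix_ne_zero`, the map
`v ↦ v · (α^{ij})` — `Ψ_α` on coefficient vectors of linear forms — is injective on each row space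
`V_ℓ = span(rows of B_ℓ)`. [cite: AgrawalEtAl2011, Cor. 7.2]
locator: paper:arxiv-1111.0582 p0017.txt:L39–L50 -/
theorem exists_forall_vecMul_powMatrix_injOn {t k n : ℕ} (B : Fin t → Matrix (Fin k) (Fin n) K)
    (hB : ∀ ℓ, LinearIndependent K (fun a : Fin k => B ℓ a))
    (hK : ((t * n * k ^ 2 : ℕ) : Cardinal) < Cardinal.mk K) :
    ∃ α : K, ∀ ℓ, Set.InjOn
      (fun v : Fin n → K => Matrix.vecMul v (Matrix.of (fun (x : Fin n) (j : Fin k) =>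
        α ^ (((x : ℕ) + 1) * ((j : ℕ) + 1)))))
      (Submodule.span K (Set.range fun a : Fin k => B ℓ a) : Set (Fin n → K)) := by
  classical
  obtain ⟨α, hα⟩ := exists_forall_det_mul_powMatrix_ne_zero B hB hK
  refine ⟨α, fun ℓ => ?_⟩
  set W : Matrix (Fin n) (Fin k) K :=
    Matrix.of (fun (x : Fin n) (j : Fin k) => α ^ (((x : ℕ) + 1) * ((j : ℕ) + 1))) with hW
  -- linear, so injective on the subspace iff its kernel there is trivial
  have hker : ∀ v ∈ (Submodule.span K (Set.range fun a : Fin k => B ℓ a) : Set (Fin n → K)),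
      Matrix.vecMul v W = 0 → v = 0 := by
    intro v hv h0
    obtain ⟨c, rfl⟩ := (Submodule.mem_span_range_iff_exists_fun K).1 hv
    have hc : Matrix.vecMul c (B ℓ) = ∑ i, c i • B ℓ i := by
      funext x
      simp [Matrix.vecMul, dotProduct, Finset.sum_apply, Pi.smul_apply, smul_eq_mul]
    rw [← hc] at h0 ⊢
    rw [Matrix.vecMul_vecMul] at h0
    have hc0 : c = 0 := Matrix.eq_zero_of_vecMul_eq_zero (hα ℓ) h0
    simp [hc0]
  intro v hv w hw hvw
  have hsub : Matrix.vecMul (v - w) W = 0 := by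
    rw [Matrix.sub_vecMul]
    exact sub_eq_zero.2 hvw
  exact sub_eq_zero.1 (hker (v - w) (Submodule.sub_mem _ hv hw) hsub)

end RankCondenserPrinted

section PsiAlpha

variable {K : Type*} [Field K]

/-- The linear form with coefficient vector `u`: `∑_j u_j y_j`. Coefficient extraction shows that
`u ↦ ∑_j u_j y_j` is injective. [folklore] -/
private theorem linearForm_injective {k : ℕ} :
    Function.Injective (fun u : Fin k → K => (∑ j : Fin k, C (u j) * X j : MvPolynomial (Fin k) K)) := by
  classical
  have hcoeff : ∀ (u : Fin k → K) (j : Fin k),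
      coeff (Finsupp.single j 1) (∑ j' : Fin k, C (u j') * X j' : MvPolynomial (Fin k) K) = u j := by
    intro u j
    rw [coeff_sum]
    simp only [coeff_C_mul, coeff_X, Finsupp.single_left_inj (one_ne_zero : (1 : ℕ) ≠ 0), mul_ite,
      mul_one, mul_zero, Finset.sum_ite_eq', Finset.mem_univ, if_true]
  intro u w h
  funext j
  have h' := congrArg (coeff (Finsupp.single j 1)) h
  simpa only [hcoeff] using h'

/-- `Ψ_α : x_i ↦ ∑_j y_j α^{ij}` on a linear form: `Ψ_α (∑_i v_i x_i) = ∑_j (v · W_α)_j y_j` with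
`W_α = (α^{ij})` — the dictionary between Cor. 7.2's linear polynomials and coefficient vectors.
[cite: AgrawalEtAl2011, Cor. 7.2] locator: paper:arxiv-1111.0582 p0017.txt:L39–L50 -/
theorem aeval_psi_linearForm {k n : ℕ} (α : K) (v : Fin n → K) :
    aeval (fun x : Fin n => ∑ j : Fin k, C (α ^ (((x : ℕ) + 1) * ((j : ℕ) + 1))) * X j)
        (∑ x : Fin n, C (v x) * X x : MvPolynomial (Fin n) K) =
      ∑ j : Fin k, C (Matrix.vecMul v
        (Matrix.of fun (x : Fin n) (j : Fin k) => α ^ (((x : ℕ) + 1) * ((j : ℕ) + 1))) j) * X j := by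
  simp only [map_sum, map_mul, aeval_C, aeval_X, algebraMap_eq, Matrix.vecMul, dotProduct,
    Matrix.of_apply, Finset.mul_sum]
  rw [Finset.sum_comm]
  refine Finset.sum_congr rfl fun j _ => ?_
  rw [Finset.sum_mul]
  refine Finset.sum_congr rfl fun x _ => ?_
  rw [mul_assoc]

/-- **ASSS Corollary 7.2 as printed, on linear polynomials:** for `α` as above, the homomorphism
`Ψ_α : x_i ↦ ∑_{j=1}^k y_j α^{ij}` (`aeval`) is injective on (the linear forms of) each `V_ℓ`,
`V_ℓ` = the linear forms whose coefficient vectors lie in the row space of `B_ℓ` (a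
`k`-dimensional subspace of linear polynomials, given by a basis). Constant terms are fixed by
`Ψ_α` and play no role, so homogeneous linear forms are typed.
[cite: AgrawalEtAl2011, Cor. 7.2] locator: paper:arxiv-1111.0582 p0017.txt:L39–L50 -/
theorem exists_forall_aeval_psi_injOn {t k n : ℕ} (B : Fin t → Matrix (Fin k) (Fin n) K)
    (hB : ∀ ℓ, LinearIndependent K (fun a : Fin k => B ℓ a))
    (hK : ((t * n * k ^ 2 : ℕ) : Cardinal) < Cardinal.mk K) :
    ∃ α : K, ∀ ℓ, Set.InjOn
      (aeval (fun x : Fin n => ∑ j : Fin k, C (α ^ (((x : ℕ) + 1) * ((j : ℕ) + 1))) * X j) :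
        MvPolynomial (Fin n) K → MvPolynomial (Fin k) K)
      ((fun v : Fin n → K => (∑ x : Fin n, C (v x) * X x : MvPolynomial (Fin n) K)) ''
        (Submodule.span K (Set.range fun a : Fin k => B ℓ a) : Set (Fin n → K))) := by
  obtain ⟨α, hα⟩ := exists_forall_vecMul_powMatrix_injOn B hB hK
  refine ⟨α, fun ℓ => ?_⟩
  rintro _ ⟨v, hv, rfl⟩ _ ⟨w, hw, rfl⟩ h
  have h' : Matrix.vecMul v (Matrix.of fun (x : Fin n) (j : Fin k) =>
        α ^ (((x : ℕ) + 1) * ((j : ℕ) + 1))) =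
      Matrix.vecMul w (Matrix.of fun (x : Fin n) (j : Fin k) =>
        α ^ (((x : ℕ) + 1) * ((j : ℕ) + 1))) := by
    apply linearForm_injective
    have h2 := h
    simp only [aeval_psi_linearForm] at h2
    exact h2
  rw [hα ℓ hv hw h']

end PsiAlpha

end ASSS16

/-! ### FSV Lemma 52 [ASSS16] modulo Fact 51; characteristic-0 corollaries; Thm. 9 assembly -/

section Headline

open Literature.Algebra.Polynomial.JacobianCriterion ASSS16

variable {F : Type*} [Field F]

/-- **ASSS Lemma 2.2 (Vandermonde is faithful) ⇒ FSV Lemma 52, modulo the Jacobian criterion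
(FSV Fact 51 = ASSS Fact 1 [BMS13]).** Printed (Lemma 2.2 / composition lemma, §7.1): "Wlog let
`trdeg f = r`, which then (by Jacobian criterion) is the rank of `J_x(f)`. We intend to show that
the matrix `J_y(Φ(f))` is of rank `r` … Consider the projection `J'` of `J_y(Φ(f))` obtained by
setting `y_1 = ⋯ = y_r = 0`: `J' = Ψ(J_x(f)) · J_y(Φ(x))` (chain rule); `J_y(Φ(x))` is exactly the
Vandermonde matrix … by Lemma 7.1, `rank J' = rank Ψ(J_x(f)) = r` … Hence `Φ` is indeed faithful."
and Thm. 2.1 turns faithfulness into `C(f) = 0 ⇔ C(Φ(f)) = 0`. Kernel route: `ρ = trdeg F`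
(a maximal independent subfamily `T`); Fact 51 gives `rank Jac = ρ`, the hypothesis of Lemma 52
transports it to `Φ(Jac)` over `𝔽(z)`; `exists_det_submatrix_mul_powMatrix_ne_zero` (Lemma 7.1)
yields a non-zero `ρ × ρ` minor of `Φ(Jac)·(u^{(k+1)(j+1)})` in `𝔽[z][u]`, which is the image
under `z ↦ z, s ↦ 0, t ↦ u` of the corresponding minor of the `s`-columns of the Jacobian of the
recipe applied to `F` (chain rule `pderiv_aeval` + `pderiv_recipe`); a non-zero Jacobian minor
forces the `ρ` rows to be algebraically independent (`rank Jac ≤ trdeg`,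
`det_jacobianMatrix_submatrix_eq_zero_of_not_algebraicIndependent`, val-lit t21), i.e. the recipe
is faithful, and Thm. 2.1 (`aeval_eq_zero_iff_of_faithful`) concludes.
[cite: AgrawalEtAl2011, Lemma 2.2 with proof (§7.1); ForbesShpilkaVolk2018, Lemma 52 (seq.) = ToC Lemma 6.3]
locator: paper:arxiv-1111.0582 p0006.txt:L46–L60, p0017.txt:L56–L100 -/
theorem ForbesShpilkaVolk2018_lemma52_of_fact51 (h51 : ForbesShpilkaVolk2018_fact51 F) :
    ForbesShpilkaVolk2018_lemma52 F := by
  classical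
  intro N m M d r Fv Cp Φ hdeg htr hchar hrank
  -- the recipe
  set Ψ : Fin N → MvPolynomial (Fin M ⊕ (Fin r ⊕ Unit)) F := fun k =>
    (∑ j : Fin r, (X (Sum.inr (Sum.inl j)) : MvPolynomial (Fin M ⊕ (Fin r ⊕ Unit)) F) *
        X (Sum.inr (Sum.inr ())) ^ (((k : ℕ) + 1) * ((j : ℕ) + 1))) +
      rename Sum.inl (Φ (X k)) with hΨ
  set Θ : MvPolynomial (Fin N) F →ₐ[F] MvPolynomial (Fin M ⊕ (Fin r ⊕ Unit)) F := aeval Ψ with hΘ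
  show aeval Fv Cp ≠ 0 ↔ aeval (fun i => Θ (Fv i)) Cp ≠ 0
  -- (i) a maximal algebraically independent subfamily `T`; `ρ = |T| = trdeg F ≤ r`
  obtain ⟨T, hTind, hTmax⟩ : ∃ T : Finset (Fin m), AlgebraicIndependent F (fun i : T => Fv i) ∧
      ∀ S : Finset (Fin m), AlgebraicIndependent F (fun i : S => Fv i) → S.card ≤ T.card := by
    have hne : (Finset.univ.filter fun S : Finset (Fin m) =>
        AlgebraicIndependent F (fun i : S => Fv i)).Nonempty := by
      refine ⟨∅, Finset.mem_filter.2 ⟨Finset.mem_univ _, ?_⟩⟩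
      haveI : IsEmpty (↥(∅ : Finset (Fin m))) := ⟨fun x => Finset.notMem_empty x.1 x.2⟩
      exact algebraicIndependent_empty_type
    obtain ⟨T, hT, hmax⟩ := Finset.exists_max_image _ Finset.card hne
    exact ⟨T, (Finset.mem_filter.1 hT).2,
      fun S hS => hmax S (Finset.mem_filter.2 ⟨Finset.mem_univ _, hS⟩)⟩
  have hρr : T.card ≤ r := htr T hTind
  have htrρ : TrdegLE F Fv T.card := fun S hS => hTmax S hS
  have hcharρ : ringChar F = 0 ∨ d ^ T.card < ringChar F := by
    rcases hchar with h | h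
    · exact Or.inl h
    · right
      rcases Nat.eq_zero_or_pos d with hd | hd
      · subst hd
        have hp : ringChar F ≠ 1 := CharP.ringChar_ne_one
        have h1 : 0 < ringChar F := lt_of_le_of_lt (Nat.zero_le _) h
        calc 0 ^ T.card ≤ 1 ^ T.card := Nat.pow_le_pow_left (Nat.zero_le 1) _
          _ = 1 := one_pow _
          _ < ringChar F := by omega
      · exact (Nat.pow_le_pow_right hd hρr).trans_lt h
  -- (ii) Fact 51: `rank Jac_X(F) = ρ`, hence `rank_{𝔽(z)} Φ(Jac_X(F)) = ρ`
  have hJ : jacobianRank Fv = T.card := h51 N m d T.card Fv hdeg htrρ ⟨T, rfl, hTind⟩ hcharρ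
  set J := jacobianMatrix Fv with hJdef
  have hρ : T.card ≤ ((J.map Φ).map (algebraMap (MvPolynomial (Fin M) F)
      (FractionRing (MvPolynomial (Fin M) F)))).rank := by
    rw [Matrix.map_map, ← hJ, hrank]
    exact le_rfl
  -- (iii) Lemma 7.1: a non-zero `ρ × ρ` minor of `Φ(Jac)·(u^{(k+1)(j+1)})` in `𝔽[z][u]`
  obtain ⟨rI, cI, hmin⟩ := exists_det_submatrix_mul_powMatrix_ne_zero (J.map Φ) hρ hρr
  -- (iv) the substitution `γ : z ↦ z, s ↦ 0, t ↦ u` into `𝔽[z][u]`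
  set γ : MvPolynomial (Fin M ⊕ (Fin r ⊕ Unit)) F →ₐ[F] Polynomial (MvPolynomial (Fin M) F) :=
    aeval (Sum.elim (fun i => Polynomial.C (X i))
      (Sum.elim (fun _ => 0) (fun _ => Polynomial.X))) with hγ
  have hγC : ∀ p : MvPolynomial (Fin M) F, γ (rename Sum.inl p) = Polynomial.C p := by
    intro p
    have h1 : (γ.comp (rename Sum.inl) : MvPolynomial (Fin M) F →ₐ[F] _) =
        IsScalarTower.toAlgHom F (MvPolynomial (Fin M) F) (Polynomial (MvPolynomial (Fin M) F)) := by
      refine algHom_ext fun i => ?_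
      rw [AlgHom.comp_apply, rename_X, hγ, aeval_X, Sum.elim_inl, IsScalarTower.toAlgHom_apply,
        Polynomial.algebraMap_eq]
    have h2 := congrArg (fun φ => φ p) h1
    simpa only [AlgHom.comp_apply, IsScalarTower.toAlgHom_apply, Polynomial.algebraMap_eq] using h2
  have hγΘ : ∀ q : MvPolynomial (Fin N) F, γ (Θ q) = Polynomial.C (Φ q) := by
    intro q
    have h1 : γ.comp Θ = (IsScalarTower.toAlgHom F (MvPolynomial (Fin M) F)
        (Polynomial (MvPolynomial (Fin M) F))).comp Φ := by
      refine algHom_ext fun k => ?_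
      rw [AlgHom.comp_apply, AlgHom.comp_apply, hΘ, aeval_X, hΨ]
      simp only [map_add, map_sum, map_mul, map_pow, hγC]
      rw [IsScalarTower.toAlgHom_apply, Polynomial.algebraMap_eq]
      simp [hγ]
    have h2 := congrArg (fun φ => φ q) h1
    simpa only [AlgHom.comp_apply, IsScalarTower.toAlgHom_apply, Polynomial.algebraMap_eq] using h2
  -- (v) the `s`-columns of the Jacobian of the recipe, mapped by `γ`, are `Φ(Jac)·(u^{(k+1)(j+1)})`
  set JΘ := jacobianMatrix (fun i => Θ (Fv i)) with hJΘ
  have hcol : ∀ (i : Fin m) (j : Fin r), γ (JΘ i (Sum.inr (Sum.inl j))) =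
      ((J.map Φ).map (Polynomial.C : MvPolynomial (Fin M) F →+* _) *
        Matrix.of (fun (k : Fin N) (j : Fin r) =>
          (Polynomial.X : Polynomial (MvPolynomial (Fin M) F)) ^ (((k : ℕ) + 1) * ((j : ℕ) + 1))))
        i j := by
    intro i j
    rw [hJΘ, jacobianMatrix_apply, hΘ, pderiv_aeval, map_sum, Matrix.mul_apply]
    refine Finset.sum_congr rfl fun k _ => ?_
    rw [map_mul, hΨ]
    erw [pderiv_recipe (Φ (X k)) k j]
    rw [map_pow, ← hΘ, hγΘ]
    have hγt : γ (X (Sum.inr (Sum.inr ()))) = Polynomial.X := by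
      rw [hγ, aeval_X]
      rfl
    simp only [hγt, Matrix.map_apply, Matrix.of_apply, hJdef, jacobianMatrix_apply]
  have hSm : (JΘ.submatrix rI (fun b => Sum.inr (Sum.inl (cI b)))).det ≠ 0 := by
    intro h0
    apply hmin
    have h1 := congrArg γ h0
    rw [map_zero, AlgHom.map_det] at h1
    rw [← h1]
    congr 1
    refine Matrix.ext fun a b => ?_
    simp only [AlgHom.mapMatrix_apply, Matrix.map_apply, Matrix.submatrix_apply]
    exact (hcol _ _).symm
  -- (vi) a non-zero Jacobian minor ⇒ the `ρ` rows are algebraically independent (faithfulness)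
  have hind : AlgebraicIndependent F (fun a : Fin T.card => Θ (Fv (rI a))) := by
    by_contra h
    exact hSm (det_jacobianMatrix_submatrix_eq_zero_of_not_algebraicIndependent
      (fun a : Fin T.card => Θ (Fv (rI a))) h (fun b => Sum.inr (Sum.inl (cI b))))
  have hrIinj : Function.Injective rI := fun a b hab =>
    hind.injective (by simp only [hab])
  -- the subfamily `S = image rI`
  set S : Finset (Fin m) := Finset.univ.image rI with hSdef
  have hS : AlgebraicIndependent F (fun i : S => Θ (Fv i)) := by
    have hsurj : ∀ x : S, ∃ a, rI a = x := fun x => by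
      obtain ⟨a, -, ha⟩ := Finset.mem_image.1 x.2
      exact ⟨a, ha⟩
    choose g hg using hsurj
    have hginj : Function.Injective g := fun x y hxy =>
      Subtype.ext (by rw [← hg x, ← hg y, hxy])
    have e : (fun i : S => Θ (Fv i)) = (fun a : Fin T.card => Θ (Fv (rI a))) ∘ g :=
      funext fun x => by simp [hg x]
    rw [e]
    exact hind.comp g hginj
  have hScard : S.card = T.card := by
    rw [hSdef, Finset.card_image_of_injective _ hrIinj, Finset.card_univ, Fintype.card_fin]
  -- (vii) Thm. 2.1
  exact not_congr (aeval_eq_zero_iff_of_faithful Fv Θ S hS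
    (fun S' hS' => hScard ▸ hTmax S' hS') Cp)

/-- Pointwise-in-`F` packaging (the assembly files take `∀ F, …` hypotheses).
[cite: AgrawalEtAl2011, Lemma 2.2; ForbesShpilkaVolk2018, Lemma 52 (seq.) = ToC Lemma 6.3] -/
theorem ForbesShpilkaVolk2018_lemma52_of_facts
    (h51 : ∀ (F : Type) [Field F], ForbesShpilkaVolk2018_fact51 F) :
    ∀ (F : Type) [Field F], ForbesShpilkaVolk2018_lemma52 F :=
  fun F _ => ForbesShpilkaVolk2018_lemma52_of_fact51 (h51 F)

/-- **FSV Lemma 53 (ToC Lemma 6.4, hitting half) modulo Fact 51 alone:** Lemma 52 ⇐ Fact 51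
(this file) composed with Lemma 53 ⇐ Lemma 52 (`ForbesShpilkaVolk2018_lemma53_of_lemma52`,
`FSV18Lemma53Reduction.lean`, val-lit t21). [cite: ForbesShpilkaVolk2018, Lemma 53 (seq.) = ToC Lemma 6.4] -/
theorem ForbesShpilkaVolk2018_lemma53_of_fact51 (h51 : ForbesShpilkaVolk2018_fact51 F) :
    ForbesShpilkaVolk2018_lemma53 F :=
  ForbesShpilkaVolk2018_lemma53_of_lemma52 (ForbesShpilkaVolk2018_lemma52_of_fact51 h51)

/-- **FSV Lemma 52 [ASSS16, Lemma 2.2] is a THEOREM in characteristic `0`:** by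
`ForbesShpilkaVolk2018_fact51_of_charZero` (the Jacobian criterion in characteristic `0`,
`FSV18JacobianCriterionCharZero.lean`, val-lit t21) and `ForbesShpilkaVolk2018_lemma52_of_fact51`.
[cite: AgrawalEtAl2011, Lemma 2.2; ForbesShpilkaVolk2018, Lemma 52 (seq.) = ToC Lemma 6.3] -/
theorem ForbesShpilkaVolk2018_lemma52_of_charZero [CharZero F] : ForbesShpilkaVolk2018_lemma52 F :=
  ForbesShpilkaVolk2018_lemma52_of_fact51 ForbesShpilkaVolk2018_fact51_of_charZero

/-- **FSV Lemma 53 (ToC Lemma 6.4) is a THEOREM in characteristic `0`.**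
[cite: ForbesShpilkaVolk2018, Lemma 53 (seq.) = ToC Lemma 6.4] -/
theorem ForbesShpilkaVolk2018_lemma53_of_charZero [CharZero F] : ForbesShpilkaVolk2018_lemma53 F :=
  ForbesShpilkaVolk2018_lemma53_of_fact51 ForbesShpilkaVolk2018_fact51_of_charZero

/-- **FSV Thm. 9 (ToC Thm. 1.10), bullet "arbitrary circuits composed with sparse polynomials of
transcendence degree `O(1)`" — a THEOREM over fields of characteristic `0`** (the conjunct
`FSV2018_thm9_sparseTrdeg` of the LOAD-BEARING `FSV2018_thm9`, instantiated at `char 𝔽 = 0`, where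
its characteristic hypothesis is automatic): over every infinite field of characteristic `0`, the
multilinear `ΣΠΣ` formulas of size `(⌊log₂ s⌋ + n + 2)^{2r+2}` are a succinct hitting set for
`C(F_1, …, F_M)` with `s`-sparse `F_i` of degree `≤ d` and `trdeg ≤ r`. Proof = print's chain, now
closed in the kernel: Cor. 54's generator `𝒢^{BMS}_{r,s}` hits the class (Lemma 53 ⇐ Lemma 52
[ASSS16] ⇐ Fact 51 [BMS13], the last a theorem in characteristic `0`) and is `ΣΠΣ`-succinct
(`isSuccinctGenerator_bmsGenCoeff`), fed to Lemma 14 (`multilinearSPSHits_of_generator`).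
[cite: ForbesShpilkaVolk2018, Thm. 9 bullet 7 and Cor. 54 (seq.) = ToC Thm. 1.10 and Cor. 6.5] -/
theorem FSV2018_thm9_sparseTrdeg_charZero (r : ℕ) :
    ∃ c : ℕ, ∀ (F : Type) [Field F] [CharZero F] [Infinite F] (n s d : ℕ),
      MultilinearSPSHits F n ((Nat.log 2 s + n + 2) ^ c)
        (sparseTrdegClass F (multilinearMonomials n) r s d) :=
  ⟨2 * r + 2, fun F _ _ _ n s d =>
    multilinearSPSHits_of_generator
      (ForbesShpilkaVolk2018_lemma53_of_charZero (F := F) n r s d (Or.inl (ringChar.eq F 0)))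
      (isSuccinctGenerator_bmsGenCoeff r s) (bms_topFanIn_mul_le r s n)⟩

end Headline

end Literature.Computability.AlgebraicComplexity

end
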